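import Summits.ResolutionOfSingularities.ResolutionOfSingularities.Theorems.FrobeniusClosingPatchingRelPerfectDepthWeightTwoBCJS
import Literature.AlgebraicGeometry.Resolution.EmbeddedResolutionExcellentSurfacesSequence
import Literature.AlgebraicGeometry.Resolution.BlowupDisjointCentreSplitting
import Literature.AlgebraicGeometry.Resolution.BlowupOffCentre
import Literature.AlgebraicGeometry.Resolution.SubschemeRegularStalks
import Literature.AlgebraicGeometry.Resolution.StalkIdealLemmas
import Literature.AlgebraicGeometry.Resolution.RegularCentreComponents
import Literature.AlgebraicGeometry.Resolution.MarkedIdealsLemmas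
import HarnessLib

/-!
# Crux `PatchingRelPerfect` (stmt-ResolutionOfSingularities-16161), chain W5.2 — T6-E1b residual, the `SingCentres₃`
# discharge (RESTART loop): FROZEN regular components ride along a CJS-type sequence

[OURS · L1 W5.2 · `SingCentres₃` discharge = RESTART AT THE FIRST REGULAR COMPONENT (res-L1-w52-plan-1 RULING R4 (3); res-type-049
first refusal, TAKING 2026-08-27T12:39Z), brick R1 «frozen part», F-72-INDEPENDENT] Fact-free; NOT statements of the manuscript under
review.

THE POINT. The restart loop runs a Cossart–Jannsen–Saito-type sequence on the UNFROZEN part `Y` of the current strict transform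
`X_j = Y ⊔ F`, the FROZEN part `F` being a union of REGULAR connected components (closed, disjoint from `cl Y`). Every centre of
such a sequence lies in the strict transforms of `Y`, hence stays away from the lifts of `F`, over which every blowing up is a
local isomorphism. This file proves that the sequence on `Y` IS a sequence on `Y ⊔ F` in the tree's per-step predicate
`IsBPermissibleSequence` («centre inside the singular locus of the strict transform» at every step): the strict transforms are
`Y_i ⊔ σ⁻¹F`, the per-step clauses (`hsub`, `hsing`, `hperm`) being STALK-LOCAL at points of the centre, which lie off `σ⁻¹F`;
the lift `σ⁻¹F` stays disjoint from `cl Y_i` and REGULAR (tree `IsBlowup.isRegular_subscheme_vanishingIdeal_preimage`); and at the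
END a regular `cl Y_m` and the regular lift give a regular `cl (Y_m ∪ σ⁻¹F)`. Plus the concatenation of two such sequences.

* `seq_trans` — concatenation of `IsBPermissibleSequence` derivations;
* `stalkIdeal_vanishingIdeal_sup_of_not_mem` — `𝓘(Y ⊔ F)_x = 𝓘(Y)_x` off `F`;
* `isRegular_subscheme_vanishingIdeal_sup` — a disjoint union of two regular reduced closed subschemes is regular;
* `seq_union_frozen` — **MAIN**: `IsBPermissibleSequence Y B σ Y' B'`, `F` closed with `cl Y ∩ F = ∅` and `𝓘(F)` regular ⇒
  `IsBPermissibleSequence (Y ∪ F) B σ (Y' ∪ σ⁻¹F) B'`, `cl Y' ∩ σ⁻¹F = ∅`, `𝓘(σ⁻¹F)` regular;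
* `isRegular_closure_union_frozen` — the END.

AI-written; AI review is weaker than expert review.

## References
* V. Cossart, U. Jannsen, S. Saito, LNM 2270 (2020), (6.2), Def. 6.8, Def. 6.23 (3), Cor. 6.26. [CossartJannsenSaito2020]
* U. Görtz, T. Wedhorn, *Algebraic Geometry I* (2nd ed. 2020), Prop. 13.91 (3). [GortzWedhorn2020]
* The Stacks Project, Tags 0357, 033B. [StacksProject]
-/

-- `Summit.<Summit>.<Sub>.Theorems` with `Sub = Summit` (single-conjunct summit, D-0017)
set_option linter.dupNamespace false

noncomputable section

open CategoryTheory CategoryTheory.Limits AlgebraicGeometry TopologicalSpace IsLocalRing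
open Literature.AlgebraicGeometry.Resolution Scheme.IdealSheafData

namespace Summit.ResolutionOfSingularities.ResolutionOfSingularities.Theorems

universe u

namespace LegalRestart

variable {Z : Scheme.{u}}

open WeightTwoB (preimage_comp' preimage_id')

/-! ## §1 Concatenation of CJS-type sequences -/

/-- **Concatenation**: a sequence of complete `𝓑`-permissible blowings up over `X` followed by one over its end state is one over
`X`. [cite: CossartJannsenSaito2020, (6.2)] -/
theorem seq_trans {X B : Set Z} {Z' : Scheme.{u}} {σ : Z' ⟶ Z} {X' B' : Set Z'}
    (h₁ : IsBPermissibleSequence X B σ X' B') :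
    ∀ {Z'' : Scheme.{u}} {ρ : Z'' ⟶ Z'} {X'' B'' : Set Z''}, IsBPermissibleSequence X' B' ρ X'' B'' →
      IsBPermissibleSequence X B (ρ ≫ σ) X'' B'' := by
  intro Z'' ρ X'' B'' h₂
  induction h₂ with
  | refl => simpa using h₁
  | @blowup Z₁ Z₂ ρ X₁ B₁ h C τ hτ hreg hsub hsing hperm hnc ih =>
    have := IsBPermissibleSequence.blowup ih C τ hτ hreg hsub hsing hperm hnc
    simpa only [Category.assoc] using this

/-! ## §2 Stalk locality of the reduced structure of a union -/

/-- **`𝓘(Y ∪ F)_x = 𝓘(Y)_x` at a point off the closed set `F`** (`𝓘(Y ⊔ F) = 𝓘(Y) ⊓ 𝓘(F)` and `𝓘(F)_x = 𝒪_x`). [folklore] -/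
theorem stalkIdeal_vanishingIdeal_sup_of_not_mem {Y F : Closeds Z} {x : Z} (hx : x ∉ (F : Set Z)) :
    stalkIdeal (vanishingIdeal (Y ⊔ F)) x = stalkIdeal (vanishingIdeal Y) x := by
  rw [Scheme.IdealSheafData.vanishingIdeal_sup, stalkIdeal_inf, stalkIdeal_vanishingIdeal_of_not_mem hx, inf_top_eq]

/-- The closure of `Y ∪ F` for `F` closed, as a `Closeds`. [folklore] -/
theorem closeds_closure_union {Y F : Set Z} (hF : IsClosed F) :
    (⟨closure (Y ∪ F), isClosed_closure⟩ : Closeds Z) = ⟨closure Y, isClosed_closure⟩ ⊔ ⟨F, hF⟩ := by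
  ext1
  simp only [Closeds.coe_mk, Closeds.coe_sup, closure_union, hF.closure_eq]

/-! ## §3 A disjoint union of regular reduced closed subschemes is regular -/

/-- **`V(𝓘(Y ⊔ F))` is regular if `V(𝓘(Y))` and `V(𝓘(F))` are and `Y ∩ F = ∅`** (quotient stalks are those of the pieces).
[cite: StacksProject, Tag 0357] -/
theorem isRegular_subscheme_vanishingIdeal_sup [IsLocallyNoetherian Z] {Y F : Closeds Z} (hd : Disjoint (Y : Set Z) F)
    (hY : Scheme.IsRegular (vanishingIdeal Y).subscheme) (hF : Scheme.IsRegular (vanishingIdeal F).subscheme) :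
    Scheme.IsRegular (vanishingIdeal (Y ⊔ F)).subscheme := by
  rw [Scheme.isRegular_subscheme_iff]
  intro x hx
  have hx' : x ∈ (Y : Set Z) ∪ F := by
    have h : x ∈ ((vanishingIdeal (Y ⊔ F)).support : Set Z) := hx
    rwa [Scheme.IdealSheafData.coe_support_vanishingIdeal, Closeds.coe_sup] at h
  rcases hx' with hxY | hxF
  · have hxF : x ∉ (F : Set Z) := Set.disjoint_left.mp hd hxY
    rw [stalkIdeal_vanishingIdeal_sup_of_not_mem hxF]
    exact (Scheme.isRegular_subscheme_iff _).mp hY x (by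
      rw [← SetLike.mem_coe, Scheme.IdealSheafData.coe_support_vanishingIdeal]; exact hxY)
  · have hxY : x ∉ (Y : Set Z) := Set.disjoint_right.mp hd hxF
    rw [sup_comm, stalkIdeal_vanishingIdeal_sup_of_not_mem hxY]
    exact (Scheme.isRegular_subscheme_iff _).mp hF x (by
      rw [← SetLike.mem_coe, Scheme.IdealSheafData.coe_support_vanishingIdeal]; exact hxF)

/-! ## §4 The frozen part rides along -/

/-- Set algebra of one step: the strict transform of `Y ∪ F` along a blowing up whose centre `D` misses the closed `F` is the
strict transform of `Y` union the preimage of `F`. [folklore] -/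
theorem closure_preimage_union_diff {Z' : Scheme.{u}} (τ : Z' ⟶ Z) {Y F D : Set Z} (hF : IsClosed F) (hFD : Disjoint F D) :
    closure (τ ⁻¹' ((Y ∪ F) \ D)) = closure (τ ⁻¹' (Y \ D)) ∪ τ ⁻¹' F := by
  have h : (Y ∪ F) \ D = (Y \ D) ∪ F := by rw [Set.union_sdiff_distrib, hFD.sdiff_eq_left]
  rw [h, Set.preimage_union, closure_union, (hF.preimage τ.continuous).closure_eq]

/-- **THE FROZEN PART RIDES ALONG** (see the module docstring): a CJS-type sequence on `Y` (initial boundary `B`) is one on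
`Y ∪ F` with strict transforms `Y_i ∪ σ⁻¹F`, for `F` closed, disjoint from `cl Y`, with `V(𝓘(F))` regular; along it `σ⁻¹F` stays
disjoint from `cl Y_i` and regular. [cite: CossartJannsenSaito2020, Def. 6.23 (3), Cor. 6.26] [cite: GortzWedhorn2020, Prop. 13.91 (3)] -/
theorem seq_union_frozen [IsLocallyNoetherian Z] {Y B F : Set Z} (hF : IsClosed F) (hd : Disjoint (closure Y) F)
    (hFreg : Scheme.IsRegular (vanishingIdeal ⟨F, hF⟩).subscheme) :
    ∀ {Z' : Scheme.{u}} {σ : Z' ⟶ Z} {Y' B' : Set Z'}, IsBPermissibleSequence Y B σ Y' B' →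
      IsBPermissibleSequence (Y ∪ F) B σ (Y' ∪ σ ⁻¹' F) B' ∧ Disjoint (closure Y') (σ ⁻¹' F) ∧
      ∃ (_ : IsLocallyNoetherian Z'),
        Scheme.IsRegular (vanishingIdeal ⟨σ ⁻¹' F, hF.preimage σ.continuous⟩).subscheme := by
  intro Z' σ Y' B' h
  induction h with
  | refl =>
    refine ⟨?_, ?_, inferInstance, ?_⟩
    · rw [preimage_id']; exact IsBPermissibleSequence.refl
    · rw [preimage_id']; exact hd
    · have hFF : (⟨⇑(𝟙 Z) ⁻¹' F, hF.preimage (Scheme.Hom.continuous (𝟙 Z))⟩ : Closeds Z) = ⟨F, hF⟩ :=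
        Closeds.ext (preimage_id' F)
      rw [hFF]; exact hFreg
  | @blowup Z' Z'' σ Y' B' h C τ hτ hreg hsub hsing hperm hnc ih =>
    obtain ⟨h₁, hdis, hln, hreg₁⟩ := ih
    haveI := hln
    haveI : IsLocallyNoetherian Z'' := hτ.isLocallyNoetherian
    set F' : Set Z' := σ ⁻¹' F with hF'def
    have hF'c : IsClosed F' := hF.preimage σ.continuous
    -- the centre lies in `cl Y'`, hence off `F'`
    have hCY : (C.support : Set Z') ⊆ closure Y' := by
      intro y hy
      have h' : y ∈ ((vanishingIdeal (⟨closure Y', isClosed_closure⟩ : Closeds Z')).support : Set Z') :=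
        support_antitone hsub hy
      rwa [Scheme.IdealSheafData.coe_support_vanishingIdeal] at h'
    have hFC : Disjoint F' (C.support : Set Z') := Set.disjoint_left.mpr fun y hyF hyC => Set.disjoint_left.mp hdis (hCY hyC) hyF
    -- the reduced structure of `cl (Y' ∪ F')` is that of `cl Y'` near the centre
    have hcl : (⟨closure (Y' ∪ F'), isClosed_closure⟩ : Closeds Z') = ⟨closure Y', isClosed_closure⟩ ⊔ ⟨F', hF'c⟩ :=
      closeds_closure_union hF'c
    have hloc : ∀ x ∈ (C.support : Set Z'),
        stalkIdeal (vanishingIdeal (⟨closure (Y' ∪ F'), isClosed_closure⟩ : Closeds Z')) x =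
          stalkIdeal (vanishingIdeal (⟨closure Y', isClosed_closure⟩ : Closeds Z')) x := fun x hx => by
      rw [hcl]
      exact stalkIdeal_vanishingIdeal_sup_of_not_mem (F := ⟨F', hF'c⟩) (Set.disjoint_right.mp hFC hx)
    -- the per-step clauses for `Y' ∪ F'`
    have hsub' : vanishingIdeal (⟨closure (Y' ∪ F'), isClosed_closure⟩ : Closeds Z') ≤ C := by
      refine le_trans (vanishingIdeal_antimono ?_) hsub
      rw [hcl]; exact le_sup_left
    have hsing' : ∀ x ∈ (C.support : Set Z'), ¬ IsRegularLocalRing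
        ((Z'.presheaf.stalk x) ⧸ stalkIdeal (vanishingIdeal ⟨closure (Y' ∪ F'), isClosed_closure⟩) x) := fun x hx => by
      rw [hloc x hx]; exact hsing x hx
    have hperm' : ∀ x ∈ (C.support : Set Z'),
        ((stalkIdeal C x).map (Ideal.Quotient.mk
          (stalkIdeal (vanishingIdeal ⟨closure (Y' ∪ F'), isClosed_closure⟩) x))).IsPermissible := fun x hx => by
      rw [hloc x hx]; exact hperm x hx
    have hstep := IsBPermissibleSequence.blowup h₁ C τ hτ hreg hsub' hsing' hperm' hnc
    -- the new strict transform is `cl τ⁻¹(Y' ∖ V(C)) ∪ (τ ≫ σ)⁻¹ F`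
    have hX : closure (τ ⁻¹' ((Y' ∪ F') \ (C.support : Set Z'))) =
        closure (τ ⁻¹' (Y' \ (C.support : Set Z'))) ∪ ⇑(τ ≫ σ) ⁻¹' F := by
      rw [closure_preimage_union_diff τ hF'c hFC, hF'def, preimage_comp']
    rw [hX] at hstep
    refine ⟨hstep, ?_, inferInstance, ?_⟩
    · -- disjointness persists
      rw [preimage_comp', ← hF'def]
      refine Set.disjoint_left.mpr fun y hy hyF => ?_
      rw [closure_closure] at hy
      have hy' : y ∈ τ ⁻¹' closure Y' :=
        closure_minimal ((Set.preimage_mono Set.sdiff_subset).trans (Set.preimage_mono subset_closure))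
          (isClosed_closure.preimage τ.continuous) hy
      exact Set.disjoint_left.mp hdis hy' hyF
    · -- the lift of `F` stays regular (the blowing up is a local isomorphism over it)
      have hFF : (⟨⇑(τ ≫ σ) ⁻¹' F, hF.preimage (τ ≫ σ).continuous⟩ : Closeds Z'') =
          (⟨F', hF'c⟩ : Closeds Z').preimage τ.continuous := by
        ext1
        rw [Closeds.coe_mk, Closeds.coe_preimage, Closeds.coe_mk, preimage_comp']
      rw [hFF]
      exact hτ.isRegular_subscheme_vanishingIdeal_preimage ⟨F', hF'c⟩ hFC hreg₁

/-- **THE END of a restart round**: if the strict transform `cl Y'` of the unfrozen part is regular (as a reduced subscheme), so is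
the full strict transform `cl (Y' ∪ σ⁻¹F)`. [cite: CossartJannsenSaito2020, Cor. 6.26] [cite: StacksProject, Tag 0357] -/
theorem isRegular_closure_union_frozen [IsLocallyNoetherian Z] {Y B F : Set Z} (hF : IsClosed F)
    (hd : Disjoint (closure Y) F) (hFreg : Scheme.IsRegular (vanishingIdeal ⟨F, hF⟩).subscheme)
    {Z' : Scheme.{u}} {σ : Z' ⟶ Z} {Y' B' : Set Z'} (h : IsBPermissibleSequence Y B σ Y' B')
    (hY' : Scheme.IsRegular (vanishingIdeal ⟨closure Y', isClosed_closure⟩).subscheme) :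
    ∃ (_ : IsLocallyNoetherian Z'),
      Scheme.IsRegular (vanishingIdeal ⟨closure (Y' ∪ σ ⁻¹' F), isClosed_closure⟩).subscheme := by
  obtain ⟨-, hdis, hln, hreg⟩ := seq_union_frozen hF hd hFreg h
  haveI := hln
  refine ⟨hln, ?_⟩
  rw [closeds_closure_union (hF.preimage σ.continuous)]
  exact isRegular_subscheme_vanishingIdeal_sup hdis hY' hreg

end LegalRestart

end Summit.ResolutionOfSingularities.ResolutionOfSingularities.Theorems

end
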